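import Summits.FinalStateConjecture.FinalStateConjecture.Theorems.StarvedNecksGapDecaySufficesStubAssembly

/-!
# Stub `stub_certificateBookkeeping` (B of line `Sketch`, crux `GapDecaySuffices`) — file 2: KINEMATICS

Elementary lemmas used by the reduction `certificateBookkeeping_of` (files 3–7): Lorentz clock
comparisons on a boosted Kerr background (late hole time ⟹ late flat time on sublinearly bounded
radii and conversely; two-point flat-time drift), the chord inequality of a concave profile
(`ρ(s') ≤ (s'/s)·ρ(s)`), the resulting DEEP-WITNESS lemma (a gap-tube point whose hole clock and radius
are within `ρ'(x⁰)/2` of those of a late point `x` with `r x ≤ 4ρ'(x⁰)` is itself late with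
`r ≤ 5ρ'` of ITS OWN flat time), separation of the analysis regions of different holes (cone separation
p106992 + sublinearity), chart-domain membership from a radius bound, restriction of open embeddings to
open subsets, and thickening of a compact parameter interval inside an open set.
Mathlib + landed `…Seam.abs_flatTime_sub_le`, `…Cones.stub_coneSeparation`; no definitions, no `sorry`.
-/

noncomputable section

open scoped Manifold ContDiff Topology ENNReal
open Filter Set Topology Literature.Geometry.Lorentzian

namespace Summit.FinalStateConjecture.FinalStateConjecture.Theorems.GapDecaySuffices.Bookkeeping

-- justified lint debt: the problem namespace repeats the summit name (`FinalStateConjecture.FinalStateConjecture`)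
set_option linter.dupNamespace false

open Summit.FinalStateConjecture.FinalStateConjecture.Theorems.NecksCertifyBargmann.Seam
  (abs_flatTime_sub_le)
open Summit.FinalStateConjecture.FinalStateConjecture.Theorems.NecksCertifyTwoCap.Cones
  (stub_coneSeparation)
open Summit.FinalStateConjecture.FinalStateConjecture.Theorems.NecksCertify.Negative (rPlus_le_two_mul)

/-! ## Clock comparisons on one boosted Kerr background -/

section Clock

variable (Λ : lorentzGroup) (c : E4) (M a : ℝ)

/-- Two-sided Lorentz clock bound, unfolded: with `γ = (Λ∂₀)⁰`, `σ = √(γ² − 1)`,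
`c⁰ + γ t(y) − σ(r(y) + |a|) ≤ y⁰ ≤ c⁰ + γ t(y) + σ(r(y) + |a|)`. [folklore] -/
theorem flatTime_mem_Icc (y : E4) :
    c 0 + ((Λ : E4 ≃L[ℝ] E4) (E4.basisVector 0)) 0 * (boostedKerrBackground Λ c M a).time y -
        Real.sqrt ((((Λ : E4 ≃L[ℝ] E4) (E4.basisVector 0)) 0) ^ 2 - 1) *
          ((boostedKerrBackground Λ c M a).radius y + |a|) ≤ y 0 ∧
      y 0 ≤ c 0 + ((Λ : E4 ≃L[ℝ] E4) (E4.basisVector 0)) 0 * (boostedKerrBackground Λ c M a).time y +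
        Real.sqrt ((((Λ : E4 ≃L[ℝ] E4) (E4.basisVector 0)) 0) ^ 2 - 1) *
          ((boostedKerrBackground Λ c M a).radius y + |a|) := by
  have h := abs_flatTime_sub_le Λ c M a y
  rw [abs_le] at h
  constructor <;> linarith [h.1, h.2]

/-- **Late hole time forces late flat time on sublinearly... (monotonically) bounded radii.**  For an
orthochronous motion and a monotone radius bound `f`: for every flat threshold `T` there is a hole time
`τ` such that `τ ≤ t(y)` and `r(y) ≤ f(y⁰)` force `T ≤ y⁰` (the lower clock bound read at `f(T)`). [folklore] -/
theorem exists_flatTime_ge_of_holeTime_ge (hγ : 0 < ((Λ : E4 ≃L[ℝ] E4) (E4.basisVector 0)) 0)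
    {f : ℝ → ℝ} (hf : Monotone f) (T : ℝ) :
    ∃ τ : ℝ, ∀ y : E4, τ ≤ (boostedKerrBackground Λ c M a).time y →
      (boostedKerrBackground Λ c M a).radius y ≤ f (y 0) → T ≤ y 0 := by
  set γ : ℝ := ((Λ : E4 ≃L[ℝ] E4) (E4.basisVector 0)) 0 with hγdef
  set σ : ℝ := Real.sqrt (γ ^ 2 - 1) with hσ
  have hσ0 : 0 ≤ σ := Real.sqrt_nonneg _
  refine ⟨(T - c 0 + σ * (|f T| + |a|) + 1) / γ, fun y hty hr ↦ ?_⟩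
  by_contra hlt
  rw [not_le] at hlt
  have h1 : f (y 0) ≤ |f T| := (hf hlt.le).trans (le_abs_self _)
  have hclock := (flatTime_mem_Icc Λ c M a y).1
  rw [← hγdef, ← hσ] at hclock
  have h2 : σ * ((boostedKerrBackground Λ c M a).radius y + |a|) ≤ σ * (|f T| + |a|) :=
    mul_le_mul_of_nonneg_left (by linarith) hσ0
  rw [div_le_iff₀ hγ] at hty
  nlinarith

/-- **Late flat time forces late hole time on sublinearly bounded radii.**  For an orthochronous
motion and a radius bound `f` with `f(s)/s → 0`: for every hole threshold `τ` there is a flat time `T`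
such that `T ≤ y⁰` and `r(y) ≤ f(y⁰)` force `τ ≤ t(y)` (the upper clock bound). [folklore] -/
theorem exists_holeTime_ge_of_flatTime_ge (hγ : 0 < ((Λ : E4 ≃L[ℝ] E4) (E4.basisVector 0)) 0)
    {f : ℝ → ℝ} (hf : Tendsto (fun s ↦ f s / s) atTop (𝓝 0)) (τ : ℝ) :
    ∃ T : ℝ, ∀ y : E4, T ≤ y 0 → (boostedKerrBackground Λ c M a).radius y ≤ f (y 0) →
      τ ≤ (boostedKerrBackground Λ c M a).time y := by
  set γ : ℝ := ((Λ : E4 ≃L[ℝ] E4) (E4.basisVector 0)) 0 with hγdef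
  set σ : ℝ := Real.sqrt (γ ^ 2 - 1) with hσ
  have hσ0 : 0 ≤ σ := Real.sqrt_nonneg _
  -- eventually `σ f(s) ≤ s/2` and `s/2 ≥ c⁰ + σ|a| + γ|τ|`
  have h1 : ∀ᶠ s in atTop, f s / s < 1 / (2 * σ + 1) :=
    hf.eventually (gt_mem_nhds (by positivity))
  obtain ⟨T, hT⟩ := Filter.eventually_atTop.1
    (h1.and ((eventually_gt_atTop (0 : ℝ)).and
      (eventually_ge_atTop (2 * (|c 0| + σ * |a| + γ * |τ|)))))
  refine ⟨T, fun y hy hr ↦ ?_⟩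
  obtain ⟨hfs, hs0, hs2⟩ := hT (y 0) hy
  rw [div_lt_iff₀ hs0] at hfs
  have hclock := (flatTime_mem_Icc Λ c M a y).2
  rw [← hγdef, ← hσ] at hclock
  have h3 : σ * f (y 0) ≤ y 0 / 2 := by
    have : σ * (1 / (2 * σ + 1) * y 0) = σ / (2 * σ + 1) * y 0 := by ring
    have h4 : σ / (2 * σ + 1) ≤ 1 / 2 := by
      rw [div_le_iff₀ (by positivity)]; linarith
    calc σ * f (y 0) ≤ σ * (1 / (2 * σ + 1) * y 0) := mul_le_mul_of_nonneg_left hfs.le hσ0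
      _ = σ / (2 * σ + 1) * y 0 := this
      _ ≤ 1 / 2 * y 0 := mul_le_mul_of_nonneg_right h4 hs0.le
      _ = y 0 / 2 := by ring
  have h5 : σ * ((boostedKerrBackground Λ c M a).radius y + |a|) ≤ y 0 / 2 + σ * |a| := by
    have := mul_le_mul_of_nonneg_left hr hσ0
    nlinarith
  -- `γ t ≥ y⁰/2 − c⁰ − σ|a| ≥ γ|τ| ≥ γτ`
  have h6 : γ * |τ| ≤ γ * (boostedKerrBackground Λ c M a).time y := by
    linarith [le_abs_self (c 0)]
  have h7 := le_of_mul_le_mul_left h6 hγ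
  linarith [le_abs_self τ]

/-- **Two-point flat-time drift** (orthochronous motion): `|y⁰ − y'⁰| ≤ γ|t y − t y'| + σ(r y + r y' + 2|a|)`.
[folklore] -/
theorem abs_flatTime_sub_flatTime_le (hγ : 0 < ((Λ : E4 ≃L[ℝ] E4) (E4.basisVector 0)) 0) (y y' : E4) :
    |y 0 - y' 0| ≤ ((Λ : E4 ≃L[ℝ] E4) (E4.basisVector 0)) 0 *
        |(boostedKerrBackground Λ c M a).time y - (boostedKerrBackground Λ c M a).time y'| +
      Real.sqrt ((((Λ : E4 ≃L[ℝ] E4) (E4.basisVector 0)) 0) ^ 2 - 1) *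
        ((boostedKerrBackground Λ c M a).radius y + (boostedKerrBackground Λ c M a).radius y' +
          2 * |a|) := by
  have h := abs_flatTime_sub_le Λ c M a y
  have h' := abs_flatTime_sub_le Λ c M a y'
  set γ : ℝ := ((Λ : E4 ≃L[ℝ] E4) (E4.basisVector 0)) 0
  set σ : ℝ := Real.sqrt (γ ^ 2 - 1)
  set t := (boostedKerrBackground Λ c M a).time
  set r := (boostedKerrBackground Λ c M a).radius
  have key : y 0 - y' 0 = (y 0 - c 0 - γ * t y) - (y' 0 - c 0 - γ * t y') + γ * (t y - t y') := by
    ring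
  rw [key]
  have hC : |γ * (t y - t y')| = γ * |t y - t y'| := by
    rw [abs_mul, abs_of_pos hγ]
  calc |y 0 - c 0 - γ * t y - (y' 0 - c 0 - γ * t y') + γ * (t y - t y')|
      ≤ |y 0 - c 0 - γ * t y - (y' 0 - c 0 - γ * t y')| + |γ * (t y - t y')| := abs_add_le _ _
    _ ≤ (|y 0 - c 0 - γ * t y| + |y' 0 - c 0 - γ * t y'|) + |γ * (t y - t y')| :=
        add_le_add (abs_sub _ _) le_rfl
    _ ≤ (σ * (r y + |a|) + σ * (r y' + |a|)) + γ * |t y - t y'| := by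
        rw [hC]; exact add_le_add (add_le_add h h') le_rfl
    _ = γ * |t y - t y'| + σ * (r y + r y' + 2 * |a|) := by ring

/-- A point whose hole radius exceeds `2M` (and `0`) lies in the chart domain (`r₊ ≤ 2M`). [folklore] -/
theorem mem_domain_of_radius (hM : 0 ≤ M) {y : E4} (h2 : 2 * M < (boostedKerrBackground Λ c M a).radius y)
    (h0 : 0 < (boostedKerrBackground Λ c M a).radius y) : y ∈ (boostedKerrBackground Λ c M a).domain := by
  show poincareInv Λ c y ∈ Kerr.exterior M a
  rw [Kerr.mem_exterior]
  exact max_lt (lt_of_le_of_lt (rPlus_le_two_mul hM a) h2) h0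

end Clock

/-! ## Concave profiles -/

section Profile

/-- **Chord inequality of a concave profile**: `ρ(s') ≤ (s'/s)·ρ(s)` for `0 < s ≤ s'` when `ρ` is
concave on `[0, ∞)` with `0 ≤ ρ(0)` (the function `ρ(s)/s` is non-increasing). [folklore] -/
theorem profile_le_div_mul {ρ : ℝ → ℝ} (hconc : ConcaveOn ℝ (Set.Ici 0) ρ) (h0 : 0 ≤ ρ 0) {s s' : ℝ}
    (hs : 0 < s) (hss' : s ≤ s') : ρ s' ≤ s' / s * ρ s := by
  have hs'0 : 0 < s' := lt_of_lt_of_le hs hss'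
  -- `s = (1 - s/s')·0 + (s/s')·s'`
  have hlam0 : 0 ≤ 1 - s / s' := by
    rw [sub_nonneg, div_le_one hs'0]; exact hss'
  have hlam1 : 0 ≤ s / s' := by positivity
  have h := hconc.2 (Set.mem_Ici.2 le_rfl) (Set.mem_Ici.2 hs'0.le) hlam0 hlam1 (by ring)
  simp only [smul_eq_mul, mul_zero, zero_add] at h
  have hs_eq : s / s' * s' = s := by field_simp
  rw [hs_eq] at h
  -- `(1 - s/s')ρ(0) + (s/s')ρ(s') ≤ ρ(s)` and `ρ(0) ≥ 0`
  have h2 : s / s' * ρ s' ≤ ρ s := by nlinarith [mul_nonneg hlam0 h0]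
  have h3 : ρ s' = s' / s * (s / s' * ρ s') := by field_simp
  rw [h3]
  exact mul_le_mul_of_nonneg_left h2 (by positivity)

/-- Additive form of the chord inequality: `ρ(s') ≤ ρ(s) + (s' − s)·(ρ(s)/s)` for `0 < s ≤ s'`. [folklore] -/
theorem profile_le_add {ρ : ℝ → ℝ} (hconc : ConcaveOn ℝ (Set.Ici 0) ρ) (h0 : 0 ≤ ρ 0) {s s' : ℝ}
    (hs : 0 < s) (hss' : s ≤ s') : ρ s' ≤ ρ s + (s' - s) * (ρ s / s) := by
  have h := profile_le_div_mul hconc h0 hs hss'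
  have : s' / s * ρ s = ρ s + (s' - s) * (ρ s / s) := by field_simp; ring
  linarith

/-- A profile with `ρ(s)/s → 0` is eventually below `ε·s`. [folklore] -/
theorem eventually_le_mul_of_tendsto_div {ρ : ℝ → ℝ} (h : Tendsto (fun s ↦ ρ s / s) atTop (𝓝 0))
    {ε : ℝ} (hε : 0 < ε) : ∀ᶠ s in atTop, ρ s ≤ ε * s := by
  filter_upwards [h.eventually (gt_mem_nhds hε), eventually_gt_atTop (0 : ℝ)] with s hs hs0
  rw [div_lt_iff₀ hs0] at hs
  exact hs.le

end Profile

/-! ## The deep-witness lemma -/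

section Deep

variable (Λ : lorentzGroup) (c : E4) (M a : ℝ)

set_option maxHeartbeats 800000 in
/-- **Deep witnesses are late and deep in their own flat time.**  For an orthochronous motion and a
monotone profile `ρ' ≥ max(1, |a|)`, concave on `[0, ∞)` and sublinear: for every threshold `τe` there
is a hole time `τ⋆` such that whenever `τ⋆ ≤ t(x)`, `r(x) ≤ 4ρ'(x⁰)` and `x''` has hole clock and
radius within `ρ'(x⁰)/2` of those of `x`, then `τe ≤ t(x'')`, `τe ≤ x''⁰` and `r(x'') ≤ 5ρ'(x''⁰)`
(and `τe ≤ x⁰`).  Two-point drift + chord inequality + the two lateness transfers. [folklore] -/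
theorem exists_deepWitness_late (hγ : 0 < ((Λ : E4 ≃L[ℝ] E4) (E4.basisVector 0)) 0) {ρ' : ℝ → ℝ}
    (hmono : Monotone ρ') (hconc : ConcaveOn ℝ (Set.Ici 0) ρ') (hone : ∀ s, 1 ≤ ρ' s)
    (ha : ∀ s, |a| ≤ ρ' s) (hsub : Tendsto (fun s ↦ ρ' s / s) atTop (𝓝 0)) (τe : ℝ) :
    ∃ τs : ℝ, ∀ x x'' : E4, τs ≤ (boostedKerrBackground Λ c M a).time x →
      (boostedKerrBackground Λ c M a).radius x ≤ 4 * ρ' (x 0) →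
      |(boostedKerrBackground Λ c M a).time x'' - (boostedKerrBackground Λ c M a).time x| ≤ ρ' (x 0) / 2 →
      |(boostedKerrBackground Λ c M a).radius x'' - (boostedKerrBackground Λ c M a).radius x| ≤ ρ' (x 0) / 2 →
      τe ≤ x 0 ∧ τe ≤ (boostedKerrBackground Λ c M a).time x'' ∧ τe ≤ x'' 0 ∧
        (boostedKerrBackground Λ c M a).radius x'' ≤ 5 * ρ' (x'' 0) := by
  set γ : ℝ := ((Λ : E4 ≃L[ℝ] E4) (E4.basisVector 0)) 0 with hγdef
  set σ : ℝ := Real.sqrt (γ ^ 2 - 1) with hσ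
  set t := (boostedKerrBackground Λ c M a).time with ht
  set r := (boostedKerrBackground Λ c M a).radius with hr
  have hσ0 : 0 ≤ σ := Real.sqrt_nonneg _
  have hρ0 : 0 ≤ ρ' 0 := zero_le_one.trans (hone 0)
  -- hole lateness of `x''` from its flat lateness (radius bound `5ρ'`)
  have hsub5 : Tendsto (fun s ↦ 5 * ρ' s / s) atTop (𝓝 0) := by
    simpa [mul_div_assoc] using hsub.const_mul 5
  obtain ⟨T₂, hT₂⟩ := exists_holeTime_ge_of_flatTime_ge Λ c M a hγ hsub5 τe
  -- the drift constants
  set A : ℝ := γ / 2 + σ * (17 / 2 + 2) with hA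
  have hA0 : 0 ≤ A := by positivity
  -- flat lateness: `x⁰ ≥ T₁` with `A ρ'(x⁰) ≤ x⁰/20`, `x⁰ ≥ 20/19 · max(T₂, τe, 1)`
  obtain ⟨T₁, hT₁⟩ := Filter.eventually_atTop.1
    ((eventually_le_mul_of_tendsto_div (ρ := fun s ↦ A * ρ' s)
      (by simpa [mul_div_assoc] using hsub.const_mul A) (show (0 : ℝ) < 1 / 20 by norm_num)).and
      ((eventually_ge_atTop (20 / 19 * max (max T₂ τe) 1)).and (eventually_gt_atTop (0 : ℝ))))
  obtain ⟨τs, hτs⟩ := exists_flatTime_ge_of_holeTime_ge Λ c M a hγ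
    (f := fun s ↦ 4 * ρ' s) (hmono.const_mul (by norm_num)) T₁
  refine ⟨τs, fun x x'' htx hrx hdt hdr ↦ ?_⟩
  have hx0 : T₁ ≤ x 0 := hτs x htx hrx
  obtain ⟨hAx, hx20, hxpos⟩ := hT₁ (x 0) hx0
  have hmax : max (max T₂ τe) 1 ≤ 19 / 20 * x 0 := by linarith
  have hT₂x : T₂ ≤ 19 / 20 * x 0 := (le_max_left _ _).trans ((le_max_left _ _).trans hmax)
  have hτex : τe ≤ 19 / 20 * x 0 := (le_max_right _ _).trans ((le_max_left _ _).trans hmax)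
  have h1x : 1 ≤ 19 / 20 * x 0 := (le_max_right _ _).trans hmax
  have hρx : 0 < ρ' (x 0) := lt_of_lt_of_le one_pos (hone _)
  -- radius of `x''`
  have hr'' : r x'' ≤ 9 / 2 * ρ' (x 0) := by
    have := (abs_le.1 hdr).2; linarith
  have hr''0 : r x'' + r x + 2 * |a| ≤ (17 / 2 + 2) * ρ' (x 0) := by linarith [ha (x 0)]
  -- drift
  have hdrift : |x'' 0 - x 0| ≤ A * ρ' (x 0) := by
    have h := abs_flatTime_sub_flatTime_le Λ c M a hγ x'' x
    rw [← hγdef, ← hσ] at h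
    have h2 : γ * |t x'' - t x| ≤ γ / 2 * ρ' (x 0) := by
      have := mul_le_mul_of_nonneg_left hdt hγ.le; linarith
    have h3 : σ * (r x'' + r x + 2 * |a|) ≤ σ * ((17 / 2 + 2) * ρ' (x 0)) :=
      mul_le_mul_of_nonneg_left hr''0 hσ0
    calc |x'' 0 - x 0| ≤ γ * |t x'' - t x| + σ * (r x'' + r x + 2 * |a|) := h
      _ ≤ γ / 2 * ρ' (x 0) + σ * ((17 / 2 + 2) * ρ' (x 0)) := add_le_add h2 h3
      _ = A * ρ' (x 0) := by rw [hA]; ring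
  have hx''lo : 19 / 20 * x 0 ≤ x'' 0 := by
    have := (abs_le.1 hdrift).1; linarith
  -- profile comparison `ρ'(x⁰) ≤ (20/19) ρ'(x''⁰)`
  have hcomp : ρ' (x 0) ≤ 20 / 19 * ρ' (x'' 0) := by
    rcases le_or_gt (x 0) (x'' 0) with hle | hgt
    · have := hmono hle
      linarith [hone (x'' 0)]
    · have hx''pos : 0 < x'' 0 := by linarith
      have h := profile_le_div_mul hconc hρ0 hx''pos hgt.le
      have hratio : x 0 / x'' 0 ≤ 20 / 19 := by
        rw [div_le_iff₀ hx''pos]; linarith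
      have hρ'' : 0 ≤ ρ' (x'' 0) := zero_le_one.trans (hone _)
      calc ρ' (x 0) ≤ x 0 / x'' 0 * ρ' (x'' 0) := h
        _ ≤ 20 / 19 * ρ' (x'' 0) := mul_le_mul_of_nonneg_right hratio hρ''
  refine ⟨by linarith, ?_, by linarith, ?_⟩
  · -- hole lateness of `x''`
    refine hT₂ x'' (by linarith) ?_
    show r x'' ≤ 5 * ρ' (x'' 0)
    linarith
  · show r x'' ≤ 5 * ρ' (x'' 0)
    linarith

end Deep

/-! ## Separation of the analysis regions of different holes -/

section Separation

variable {𝓢 : Spacetime.{0} 4} {O : Set 𝓢.carrier} {k : ℕ} (d : FinalStateDecomposition 𝓢 O k)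

/-- **Analysis regions of different holes separate.**  For an orthochronous decomposition with pairwise
distinct velocities and two families of sublinear radius profiles `f`, `g`: after some flat time, a
point within `fᵢ(y⁰)` of hole `i` is beyond `gⱼ(y⁰)` from every other hole `j` and clears every excised
tube with margin `1` (cone separation p106992 + sublinearity of `f`, `g` and of the excision radii). [folklore] -/
theorem exists_separation
    (horth : ∀ j, 0 < ((d.motion j).1 : E4 ≃L[ℝ] E4) (E4.basisVector 0) 0)
    (hdv : ∀ i j : Fin d.N, i ≠ j →
      ((d.motion i).1 : E4 ≃L[ℝ] E4) (E4.basisVector 0) ≠ ((d.motion j).1 : E4 ≃L[ℝ] E4) (E4.basisVector 0))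
    (f g : Fin d.N → ℝ → ℝ) (hf : ∀ i, Tendsto (fun s ↦ f i s / s) atTop (𝓝 0))
    (hg : ∀ i, Tendsto (fun s ↦ g i s / s) atTop (𝓝 0)) :
    ∃ T : ℝ, d.τ₀ < T ∧ ∀ (i j : Fin d.N) (y : E4), i ≠ j → T ≤ y 0 →
      (d.background i).radius y ≤ f i (y 0) →
      g j (y 0) < (d.background j).radius y ∧ d.excision j (y 0) + 1 ≤ (d.background j).radius y := by
  obtain ⟨c, hc, τc, hcone⟩ := stub_coneSeparation 𝓢 O k d horth hdv
  have hE1 : ∀ᶠ s in atTop, ∀ i, f i s ≤ c * s :=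
    Filter.eventually_all.2 fun i ↦ eventually_le_mul_of_tendsto_div (hf i) hc
  have hE2 : ∀ᶠ s in atTop, ∀ j, g j s < c * s := by
    refine Filter.eventually_all.2 fun j ↦ ?_
    filter_upwards [eventually_le_mul_of_tendsto_div (hg j) (half_pos hc), eventually_gt_atTop (0 : ℝ)]
      with s hs hs0
    nlinarith
  have hE3 : ∀ᶠ s in atTop, ∀ j, d.excision j s + 1 ≤ c * s := by
    refine Filter.eventually_all.2 fun j ↦ ?_
    filter_upwards [eventually_le_mul_of_tendsto_div (d.tendsto_excision_div j) (half_pos hc),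
      eventually_ge_atTop (2 / c)] with s hs hs2
    rw [div_le_iff₀' hc] at hs2
    nlinarith
  obtain ⟨T, hT⟩ := Filter.eventually_atTop.1
    (hE1.and (hE2.and (hE3.and ((eventually_ge_atTop τc).and (eventually_gt_atTop d.τ₀)))))
  refine ⟨T, (hT T le_rfl).2.2.2.2, fun i j y hij hy hri ↦ ?_⟩
  obtain ⟨h1, h2, h3, h4, -⟩ := hT (y 0) hy
  have key := hcone i j y hij h4 (hri.trans (h1 i))
  exact ⟨(h2 j).trans key, (h3 j).trans key.le⟩

end Separation

/-! ## Two topological lemmas -/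

section Topology

/-- Restriction of an open embedding (on `U`) to an open subset `V ⊆ U` is an open embedding. [folklore] -/
theorem isOpenEmbedding_restrict_mono {E F : Type*} [TopologicalSpace E] [TopologicalSpace F]
    {h : E → F} {U V : Set E} (hemb : IsOpenEmbedding (U.restrict h)) (hVU : V ⊆ U) (hV : IsOpen V) :
    IsOpenEmbedding (V.restrict h) := by
  refine IsOpenEmbedding.of_continuous_injective_isOpenMap ?_ ?_ ?_
  · have : V.restrict h = U.restrict h ∘ Set.inclusion hVU := by
      funext x; rfl
    rw [this]
    exact hemb.continuous.comp (continuous_inclusion hVU)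
  · intro x x' hxx'
    have := hemb.injective (a₁ := ⟨x.1, hVU x.2⟩) (a₂ := ⟨x'.1, hVU x'.2⟩) hxx'
    exact Subtype.ext (Subtype.mk.inj this)
  · intro W hW
    obtain ⟨N, hN, rfl⟩ := isOpen_induced_iff.1 hW
    have e : V.restrict h '' (Subtype.val ⁻¹' N) = h '' ((N ∩ V) ∩ U) := by
      apply Subset.antisymm
      · rintro _ ⟨⟨x, hxV⟩, hxN, rfl⟩
        exact ⟨x, ⟨⟨hxN, hxV⟩, hVU hxV⟩, rfl⟩
      · rintro _ ⟨x, ⟨⟨hxN, hxV⟩, -⟩, rfl⟩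
        exact ⟨⟨x, hxV⟩, hxN, rfl⟩
    rw [e]
    exact Location.isOpen_image_inter_of_isOpenEmbedding_restrict hemb (hN.inter hV)

/-- A compact parameter interval inside an open set of reals can be thickened. [folklore] -/
theorem exists_Icc_thicken_subset {S : Set ℝ} (hS : IsOpen S) {a b : ℝ} (hab : a ≤ b)
    (h : Set.Icc a b ⊆ S) : ∃ ε > 0, Set.Icc (a - ε) (b + ε) ⊆ S := by
  obtain ⟨ε₁, hε₁, h₁⟩ := Metric.isOpen_iff.1 hS a (h (Set.left_mem_Icc.2 hab))
  obtain ⟨ε₂, hε₂, h₂⟩ := Metric.isOpen_iff.1 hS b (h (Set.right_mem_Icc.2 hab))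
  refine ⟨min ε₁ ε₂ / 2, by positivity, fun x hx ↦ ?_⟩
  rcases lt_or_ge x a with hxa | hxa
  · refine h₁ ?_
    rw [Metric.mem_ball, Real.dist_eq, abs_lt]
    constructor <;> linarith [hx.1, min_le_left ε₁ ε₂]
  rcases le_or_gt x b with hxb | hxb
  · exact h ⟨hxa, hxb⟩
  · refine h₂ ?_
    rw [Metric.mem_ball, Real.dist_eq, abs_lt]
    constructor <;> linarith [hx.2, min_le_right ε₁ ε₂]

end Topology

end Summit.FinalStateConjecture.FinalStateConjecture.Theorems.GapDecaySuffices.Bookkeeping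

end
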